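import Literature.IUT.LogThetaLattice.StripFrameWitness
import HarnessLib

/-!
# [IUTchIII] Prop 2.1 (vi) "compatible with the Kummer isomorphisms of (ii)": an independence witness for the
# glue `LatticeGlue` (abc-iut cell, wave 4, DISCHARGE-L6 §F-b row F13-a)

Mochizuki, *Inter-universal Teichmüller Theory III*, kurims manuscript (May 2020), §2, Prop 2.1 (vi) p.61
[claim: Mochizuki2012, status: disputed] (D-0012 claim key): the natural isomorphisms
`†F^{⊢×}_△ ⥲ †F^{⊢×}_env`, `F^{⊢×}_△(†D^⊢_△) ⥲ F^{⊢×}_env(†D_>)` "are compatible with the Kummer isomorphisms of (ii)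
above and Theorem 1.5, (iii)" — i.e. the square

  `†F^{⊢×μ}_△ —(first iso; [IUTchII] Cor 4.10 (iv))→ †F^{⊢×μ}_env —(Kummer of (ii), from †F^⊩_env ⥲ F^⊩_env(†D_>))→ F^{⊢×μ}_env(†D_>)`
  `†F^{⊢×μ}_△ —(Kummer of Thm 1.5 (iii))→ F^{⊢×μ}_△(†D^⊢_△) —(second iso)→ F^{⊢×μ}_env(†D_>)`

commutes. In the tree's vocabulary (abc-iut-L6-t3's glue `LatticeGlue`, `LatticeGlue.lean` p-landed): top
route = `(G.linkData.unitPortion LatticeKind.nonGaussian).app X ≪≫ G.pilotEnvFxm_iso.app X`, bottom route =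
`G.kummerT.app X ≪≫ G.envNat.app (D(X))`. This WITNESS file (kernel-checked models in the style of t3's
`StripFrameWitness.lean`; it asserts nothing about the mathematics of [IUTchIII]) records that the square is
INDEPENDENT of the laws of `LatticeGlue`:

* `twoGlue_prop21vi_kummerSquare` — over t3's witness glue `Witness.twoGlue` (all identifications identities)
  the square COMMUTES at every Hodge theater;
* `twoGlueNeg_prop21vi_kummerSquare_fails` — over the variant `Witness.twoGlueNeg`, which differs from
  `twoGlue` ONLY in the Frobenius-like unit-portion isomorphism `ThetaLinkData.unitPortion` (the natural
  automorphism `−1` of the constant pilot strip instead of the identity; every law of `ThetaLinkData`,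
  `BiCoricData`, `ThetaMonoidData`, `ThetaCoricData` and every identification field of `LatticeGlue` still
  holds), the square FAILS at every Hodge theater.

Consequence (bookkeeping, no side taken): the printed compatibility of Prop 2.1 (vi) with the Kummer
isomorphisms of (ii) is not derivable from — nor refutable by — the current interface stack; a consumer that
needs it must receive it as an explicit glue law (candidate successor field, owner abc-iut-L6-t3:
`unitPortion_kummer : ∀ X, (linkData.unitPortion .nonGaussian).app X ≪≫ pilotEnvFxm_iso.app X =
kummerT.app X ≪≫ envNat.app (S.htToD.obj X)`). The Cor. 3.12 crew's `Thm311LinkLattice.LinkData.ofBiCoric` /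
`Thm311LinkGlue` consume only the bottom route (`BiCoricData.kummer`, `LatticeGlue.envNat`), so nothing
downstream in the tree depends on the square today. Companion of `ThetaMonoidsProofs2.lean` (same seat), where
the derivable half of (vi) — naturality / compatibility with the VERTICAL constituents of Thm 1.5 (iii) — is
proved. Nothing here bears on the disputed [IUTchIII] Cor. 3.12 or takes a side; typed ≠ proved.
-/

namespace Literature.IUT.LogThetaLattice

open CategoryTheory
open Literature.IUT.HodgeTheaters

namespace Witness

/-- **IUTchII:Cor4.10(iii)** (kurims p.160) the VARIANT Θ-link data over t3's witness frame: the same (constant)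
pilot strips as `Witness.twoTheta`, but the [IUTchII] Cor 4.10 (iv) unit-portion isomorphism
`†F^{⊢×μ}_△ ⥲ †F^{⊢×μ}_{env/gau}` is the natural automorphism `−1` of the constant strip (still natural, still
satisfying `induced_full`). [claim: Mochizuki2012, status: disputed] -/
noncomputable def twoThetaNeg : ThetaLinkData twoFrame where
  pilotDelta := toPt _
  pilotTheta _ := toPt _
  unitPortion _ := NatIso.ofComponents (fun _ => negIso) (fun _ => rfl)
  induced_full _ _ _ :=
    PolyIso.map_full_of_fullyFaithful (Functor.FullyFaithful.id Pt) _ _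

/-- **IUTchII:Cor4.10(iv)** (kurims p.160) the variant's unit-portion isomorphism at a Hodge theater IS `negIso`.
[claim: Mochizuki2012, status: disputed] -/
theorem twoThetaNeg_unitPortion_app (k : LatticeKind) (X : twoFrame.HT) :
    (twoThetaNeg.unitPortion k).app X = negIso := rfl

/-- **IUTchIII:Thm1.5(iii)** (kurims p.49) the VARIANT glue: t3's `Witness.twoGlue` with `linkData := twoThetaNeg`
(every identification isomorphism still the identity; every glue law still holds).
[claim: Mochizuki2012, status: disputed] -/
noncomputable def twoGlueNeg : LatticeGlue twoFrame where
  logData := twoLog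
  linkData := twoThetaNeg
  biCoric := twoBiCoric
  thetaMonoid := twoThetaMonoid
  coric := twoCoric
  fglRoute_iso := Iso.refl _
  fxmDeltaHT_iso := Iso.refl _
  dvDelta_iso := Iso.refl _
  fxmOfDv_iso := Iso.refl _
  fxmOfDv_dv_compat := twoGlue.fxmOfDv_dv_compat
  fxmDeltaD_iso := Iso.refl _
  fglEnv_iso := Iso.refl _
  pilotEnv_iso := Iso.refl _

/-- **IUTchIII:Prop2.1(vi)** (kurims p.61) over t3's witness glue `twoGlue` the Prop 2.1 (vi) Kummer square
COMMUTES: top route (`unitPortion` then the `F^{⊢×μ}`-shadow of the Kummer isomorphism of (ii),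
`LatticeGlue.pilotEnvFxm_iso`) = bottom route (Kummer isomorphism of Thm 1.5 (iii), `LatticeGlue.kummerT`, then
the second natural isomorphism `LatticeGlue.envNat`) — the compatibility is CONSISTENT with the interface
laws. [claim: Mochizuki2012, status: disputed] -/
theorem twoGlue_prop21vi_kummerSquare (X : twoFrame.HT) :
    (twoGlue.linkData.unitPortion LatticeKind.nonGaussian).app X ≪≫ twoGlue.pilotEnvFxm_iso.app X =
      twoGlue.kummerT.app X ≪≫ twoGlue.envNat.app (twoFrame.htToD.obj X) :=
  Iso.ext rfl

/-- **IUTchIII:Prop2.1(vi)** (kurims p.61) the top route of the variant glue has underlying morphism `−1 ∈ ℤˣ`.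
[claim: Mochizuki2012, status: disputed] -/
theorem twoGlueNeg_topRoute_hom (X : twoFrame.HT) :
    ((twoGlueNeg.linkData.unitPortion LatticeKind.nonGaussian).app X ≪≫ twoGlueNeg.pilotEnvFxm_iso.app X).hom =
      (-1 : ℤˣ) :=
  rfl

/-- **IUTchIII:Prop2.1(vi)** (kurims p.61) the bottom route of the variant glue has underlying morphism `1 ∈ ℤˣ`.
[claim: Mochizuki2012, status: disputed] -/
theorem twoGlueNeg_bottomRoute_hom (X : twoFrame.HT) :
    (twoGlueNeg.kummerT.app X ≪≫ twoGlueNeg.envNat.app (twoFrame.htToD.obj X)).hom = (1 : ℤˣ) :=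
  rfl

/-- **IUTchIII:Prop2.1(vi)** (kurims p.61) WITNESS: over the variant glue `twoGlueNeg` — which satisfies every law of
`ThetaLinkData`, `BiCoricData`, `ThetaMonoidData`, `ThetaCoricData` and `LatticeGlue` — the Prop 2.1 (vi) Kummer
square FAILS at every Hodge theater. Together with `twoGlue_prop21vi_kummerSquare`: the printed compatibility
"with the Kummer isomorphisms of (ii)" is INDEPENDENT of the glue's laws (a law the interface must carry, not a
consequence of it). [claim: Mochizuki2012, status: disputed] -/
theorem twoGlueNeg_prop21vi_kummerSquare_fails (X : twoFrame.HT) :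
    (twoGlueNeg.linkData.unitPortion LatticeKind.nonGaussian).app X ≪≫ twoGlueNeg.pilotEnvFxm_iso.app X ≠
      twoGlueNeg.kummerT.app X ≪≫ twoGlueNeg.envNat.app (twoFrame.htToD.obj X) := by
  intro h
  have h' := congrArg Iso.hom h
  rw [twoGlueNeg_topRoute_hom, twoGlueNeg_bottomRoute_hom] at h'
  exact units_ne_neg_self (1 : ℤˣ) h'.symm

/-- **IUTchIII:Prop2.1(vi)** (kurims p.61) the same independence stated once for the whole interface: it is NOT
the case that every glue over every frame satisfies the Prop 2.1 (vi) Kummer square (so no theorem of the form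
`∀ G : LatticeGlue S, ∀ X, top = bottom` can be proved from the interfaces as they stand).
[claim: Mochizuki2012, status: disputed] -/
theorem not_forall_latticeGlue_prop21vi_kummerSquare :
    ¬ ∀ (G : LatticeGlue twoFrame) (X : twoFrame.HT),
      (G.linkData.unitPortion LatticeKind.nonGaussian).app X ≪≫ G.pilotEnvFxm_iso.app X =
        G.kummerT.app X ≪≫ G.envNat.app (twoFrame.htToD.obj X) :=
  fun h => twoGlueNeg_prop21vi_kummerSquare_fails ⟨(0, 0)⟩ (h twoGlueNeg ⟨(0, 0)⟩)

end Witness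

end Literature.IUT.LogThetaLattice
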